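import Literature.MathematicalPhysics.QuantumFieldTheory.Balaban1983to89.B15Claim196T0
import Literature.MathematicalPhysics.QuantumFieldTheory.Balaban1983to89.B16Ineq178TreeGauge

/-!
# `Balaban1983to89.B16Ineq178Nested` — T. Bałaban, *Large field renormalization. II. Localization, exponentiation, and bounds for the 𝐑 operation*, Commun. Math. Phys. **122** (1989) 355–392 [Balaban1989LargeFieldII], (1.78) p. 383: the one-bond tree-gauge inequality `|B(b)|² ≦ 6(d+3)(100M(L+1)N^{β₀}R_j)^{d+2} Σ_{p′∈𝔅₀∩Ω″~_{h+1}} |(∂B)(p′)|²` PROVED on the WHOLE nested gauge `T₀` of [Balaban1989LargeFieldI] p. 196 — the chain `Λ = P⁰ ⊃ ⋯ ⊃ Pᵐ` with the trees of all its layers and the external bonds joining them — for EVERY bond of `𝔅₀`, including the bonds between two successive layers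

statement-level skeleton of published theorems with citation tags; proofs where landed; nothing here is a claim about the Yang–Mills mass gap

PDF held: `paper:balaban1989-cmp122-large-field-ii` (journal page = PDF page + 354; p. 383 = PDF p. 29, re-read AS AN
IMAGE for this file: `run/shared/lean/pub/pub-balaban/b2b-balaban-ref1/pages/1989-cmp122-large-field-II/…-p029-x2.png`);
[Balaban1989LargeFieldI] = `paper:balaban1989-cmp122-large-field-i`, pp. 195–196 (PDF pp. 21–22, renders
`…/1989-cmp122-large-field-I/…-p021-x2.png`, `…-p022-x2.png`, re-read as images for this file).

WHAT IS REPRODUCED (mega-formalization `lit-balaban`, HOME `run/shared/lean/pub/lit-balaban/`, reader/typer seat r13 =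
the B16 §1 display-level owner, generation 11; SKELETON row **B16.Eq1.78**, decl of record `B16Sect1Kernels.Ineq178`
(typed p238958); consumer-cited locus F-T4-47 of the T⁴ spine; referee ref-5).  Generation 5 of this seat
(`B16Ineq178TreeGauge`, p248131) proved (1.78) on ONE annulus `P₁ ∖ P₂` of the gauge of [I] p. 196 and recorded as NOT
modelled *"the external bonds joining the annuli into `T₀`"*; meanwhile seat p26 typed the whole chain and its tree `T₀`
(`B15TreeGaugeT0`, `…Stokes`, `…LevelChange`, `B15Claim196T0`, row B15.Claim@196) and proved, for `U1`-valued bond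
fields with `ε`-small plaquettes on `𝔅₀`, the bound `‖U^v(b) − 1‖ ≤ ((d² + 7)W² + dW)ε` for EVERY bond `b` of `𝔅₀` in
the gauge `v` of `T₀` (`T0Hyp.norm_gauge_bond_sub_one_le_B0`: bonds inside a layer by the one-annulus estimate, bonds
between the layers `i`, `i + 1` by the merged pair `(Pⁱ, Pⁱ⁺²)` and the two-level comparison of the `T₀`-path with the
merged contour).  THIS FILE knits the two: (1.78) for real (𝔤-coordinate) bond functions on all of `𝔅₀`.  P. 383 (render
re-read), verbatim: *"We have to bound one bond variable |B(b)|² by the quadratic form. By the same remark as in the case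
of the inequality (1.8), we get |B(b)|² ≦ 6(d + 3)(100M(L + 1)N^{β₀}R_j)^{d+2} Σ_{p′∈𝐁₀∩Ω″~_{h+1}} |(∂B)(p′)|², (1.78)
for a bond b ∈ 𝐁₀ ∩ Ω″~_{h+1}."*  [I] p. 196: *"The union of the above described tree graphs and bonds is denoted by
T₀. It is a tree graph in 𝔅₀, fixing completely a gauge in this set."*

THE THEOREMS (carrier = p26's single-scale chain: `ChainGeom lo hi τ m`, layers `layer lo hi i = Pⁱ ∖ Pⁱ⁺¹`, sites
`B0 lo hi m = Λ ∖ Pᵐ` of `𝔅₀`, gauge `T0Gauge`; the real bond function `B` is read multiplicatively through generation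
5's `mulField`, so that `T0Gauge (mulField B) lo hi τ m` is literally *"the bond variables equal to 1 [`B = 0`,
`stepHol_mulField_eq_one_iff`] for bonds belonging to the tree graph"* `T₀`):
* `abs_bond_le_T0` (ℓ^∞ Stokes form): if `|(∂B)(p′)| ≤ s` for the plaquettes with corners in `𝔅₀`, then
  `|B(b)| ≤ ((d² + 7)W² + dW)·s` for every bond `b` with both ends in `𝔅₀` (`W + 1` = sites per side of `Λ`, `d = n + 3`);
* **`ineq178_T0`** = (1.78) AS TYPED: `B16Sect1Kernels.Ineq178 (B(b)²) (Σ_{p′⊂𝔅₀}|(∂B)(p′)|²) M L N^{β₀} R_j (n+3)`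
  whenever the sides of `Λ` have at most `100M(L+1)N^{β₀}R_j` sites (condition (i) of [I] p. 177, `100MR_{j−N+1} ≦
  100M(L+1)N^{β₀}R_j`) and `d ≤ 100M(L+1)N^{β₀}R_j` — the printed constant is met: `((d² + 7)W² + dW)² ≤ 6(d+3)D^{d+2}`
  for `D ≥ W + 1`, `D ≥ d ≥ 3` (`t0Const_sq_le`; at `d = 3` this is the quintic `(16(D−1)² + 3(D−1))² ≤ 36D⁵`, whose
  expansion at `D = 3 + t` has non-negative coefficients);
* `ineq178_T0_vec`: the same for 𝔤-valued `B` coordinatewise in an orthonormal basis (the row's reading).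
* (v1.1, §5) the LARGE-FIELD FACTOR of p. 383 assembled on this carrier: a bond of `𝔅₀` with `|B(b)| ≧ A₁p₁(g_j)`
  forces `Σ_{p′⊂𝔅₀}|(∂B)(p′)|² ≧ [6(d+3)D^{d+2}]⁻¹(A₁p₁(g_j))²` (`plaqSum_lower_of_large_bond_T0`); with (1.77) as the
  hypothesis `B16Sect1Kernels.Ineq177` against the concrete plaquette sum, `Q > γ₀[6(d+3)D^{d+2}]⁻¹(A₁p₁)² − c`
  (`form_lower_of_large_bond_T0`), `exp(−½Q) < e^{c/2}·exp(−R_j^{−d−5}p₁²(g_j))` (`largeFieldFactor_T0`, under r13's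
  explicit largeness of `R_j`) `≦ e^{c/2}·exp(−p₀(g_j))` under the p. 383 exponent proviso
  (`largeFieldFactor_T0_le_exp_neg_p0`) — r13's `B16Sect1Kernels` arithmetic BY NAME, nothing re-derived.

THE PROOF.  As in generation 5, no additive Stokes theory is developed: `B` is embedded into p26's `U1 ℂ`-valued
framework by the one-parameter family `V_t = e^{itB}` (`B16Ineq178.phaseField`).  If `B` is in the gauge of `T₀` then so
is `V_t` (`t0Gauge_phaseField`), hence p26's gauge function `v(x) = V_t(T₀-path to x)` is identically `1` on `𝔅₀`
(`t0GaugeFn_phaseField_eq_one`, from `T0Gauge.bondsOneAlong_t0word`) and the gauge-fixed field of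
`T0Hyp.norm_gauge_bond_sub_one_le_B0` is `V_t` itself (`gaugeAct_t0GaugeFn_phaseField`); its plaquette variables are
`e^{it(∂B)(p′)}`, within `|t|·s` of `1` (`t0Hyp_phaseField`), so `‖e^{itB(b)} − 1‖ ≤ ((d² + 7)W² + dW)|t|s` for every
`t`, and the bound passes to the derivative at `t = 0` (`abs_le_of_norm_cexp_sub_one_le`).  Cauchy–Schwarz is replaced
by `|(∂B)(p′)| ≤ (Σ|(∂B)|²)^{1/2}` plaquette-wise (generation 5's `curlBoundOn_sqrt`, on `𝔅₀ = Λ ∖ Pᵐ`, `B0_eq_ann`).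

HONEST SCOPE / DEVIATIONS.  (1) SINGLE SCALE (p26's model, [I] p. 195 *"more precisely in the intersection with the
corresponding lattice. We may assume, rescaling properly, that it is the unit lattice"*; the bonds crossing `∂P₁` *"are
bonds of the larger scale"*, p. 196): all layers on one unit lattice `ℤ^{n+3}`; one common threshold `a`; the additional
`Λ`-bond `[(y₁ − 1, …), y]` and the Faddeev–Popov `δ_{T₀}` are not modelled (they carry no bond of `𝔅₀`).  (2) The sum
`Σ_{p′∈𝔅₀∩Ω″~_{h+1}}` is read as the sum over the plaquettes with their four corners in `Λ ∖ Pᵐ` (as in generation 5;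
the part of the chain inside `Ω″~_{h+1}` is the same carrier with fewer layers).  (3) `d = n + 3 ≥ 3` (print `d = 4`);
the constant `6(d+3)(·)^{d+2}` is met, the print derives none; `(d² + 7)W² + dW` is p26's.  (4) Row B16.Eq1.78's head
and decl of record are unchanged; (1.77) stays the hypothesis `Ineq177` (a leaf of [IV]); the factor arithmetic is r13's
`B16Sect1Kernels`, used by name in §5.
Every declaration is a proved theorem (no new definition, no `def … : Prop`); Mathlib + the tree only; nothing of
[IV]/[V] is asserted.  Unit `lit-balaban-r13` (literature-prover-lit-balaban-r13-g11-0).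
-/

noncomputable section

open scoped BigOperators Topology
open Complex (I)
open Filter

namespace Literature.MathematicalPhysics.QuantumFieldTheory.Balaban1983to89.B16Ineq178Nested

open B7Prop1Explicit B8Lemma1NonAbelian B15TreeGauge196 B16Ineq382 B16Ineq178

-- `Site` alone would resolve to the torus sites of `Setup.lean`: re-export the `ℤ^d` sites (as `B16Ineq178`).
export B7Prop1Explicit (Site)

variable {d : ℕ}

/-! ## §1 The gauge of `T₀` for a real bond function -/

section RealGauge

variable (B : Site d → Fin d → ℝ)

/-- For a real bond function read multiplicatively (`B16Ineq178.mulField`), "the bond variable along the letter `l`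
equals `1`" means that the real bond variable vanishes: the additive form of [I] p. 196 *"putting the bond variables
equal to 1 for bonds belonging to the tree graph"*. [cite: Balaban1989LargeFieldI, p.196] -/
theorem stepHol_mulField_eq_one_iff (x : Site d) (l : Letter d) :
    stepHol (mulField B) x l = 1 ↔ (if l.2 then B x l.1 else B (x + l.vec) l.1) = 0 := by
  unfold stepHol mulField
  split_ifs <;> simp [ofAdd_eq_one]

/-- The phase field `V_t = e^{itB}` is the image of `mulField B` under the homomorphism `a ↦ e^{ita}`, letter by
letter. [cite: Balaban1989LargeFieldII, (1.78) p.383] -/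
private theorem stepHol_phaseField (t : ℝ) (x : Site d) (l : Letter d) :
    stepHol (phaseField t B) x l = uexpHom t (stepHol (mulField B) x l) := by
  unfold stepHol phaseField mulField
  split_ifs <;> simp [uexpHom, uexp_neg]

/-- Gauge conditions along a word pass from `B` to `V_t = e^{itB}` (`e^{it·0} = 1`). [cite: Balaban1989LargeFieldII, (1.78) p.383] -/
theorem bondsOneAlong_phaseField {x : Site d} {w : List (Letter d)} (h : BondsOneAlong (mulField B) x w) (t : ℝ) :
    BondsOneAlong (phaseField t B) x w := fun w₁ w₂ l hw => by
  rw [stepHol_phaseField, h w₁ w₂ l hw, map_one]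

end RealGauge

/-! ## §2 `V_t = e^{itB}` on the chain `Λ = P⁰ ⊃ ⋯ ⊃ Pᵐ`: the gauge of `T₀` and the situation `T0Hyp` of seat p26 -/

section Chain

variable {n : ℕ} {lo hi : ℕ → Site (n + 3)} {τ : ℤ} {m : ℕ} {B : Site (n + 3) → Fin (n + 3) → ℝ}

/-- **If `B` is in the gauge of `T₀`, so is `V_t = e^{itB}`** (`B15TreeGauge196.T0Gauge`: bond variables `1` along every
contour `Γ^i_{yⁱ,x}` of every layer and on the external bonds). [cite: Balaban1989LargeFieldII, (1.78) p.383] -/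
theorem t0Gauge_phaseField (hT : T0Gauge (mulField B) lo hi τ m) (t : ℝ) : T0Gauge (phaseField t B) lo hi τ m where
  tree := fun i him x hx => bondsOneAlong_phaseField B (hT.tree i him x hx) t
  ext := fun i him => by
    have h := hT.ext i him
    have h0 : B (lo (i + 1) - e i0) i0 = 0 := by simpa [mulField] using h
    change uexp (t * B (lo (i + 1) - e i0) i0) = 1
    rw [h0, mul_zero, uexp_zero]

/-- In the gauge of `T₀` the gauge function `v(x) = V_t(T₀-path to x)` of seat p26 is identically `1` on `𝔅₀` (the
field is ALREADY gauge fixed). [cite: Balaban1989LargeFieldII, (1.78) p.383] -/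
theorem t0GaugeFn_phaseField_eq_one (hC : ChainGeom lo hi τ m) (hT : T0Gauge (mulField B) lo hi τ m) (t : ℝ)
    {x : Site (n + 3)} (hx : x ∈ B0 lo hi m) : t0GaugeFn (phaseField t B) lo hi τ x = 1 := by
  obtain ⟨i, him, hxi⟩ := hx
  rw [hC.t0GaugeFn_eq _ him hxi]
  exact hol_eq_one_of_bondsOneAlong ((t0Gauge_phaseField hT t).bondsOneAlong_t0word hC him hxi)

/-- Hence p26's gauge-fixed field `V_t^v` IS `V_t` on the bonds of `𝔅₀`. [cite: Balaban1989LargeFieldII, (1.78) p.383] -/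
theorem gaugeAct_t0GaugeFn_phaseField (hC : ChainGeom lo hi τ m) (hT : T0Gauge (mulField B) lo hi τ m) (t : ℝ)
    {x : Site (n + 3)} {μ : Fin (n + 3)} (hx : x ∈ B0 lo hi m) (hx' : x + e μ ∈ B0 lo hi m) :
    gaugeAct (t0GaugeFn (phaseField t B) lo hi τ) (phaseField t B) x μ = phaseField t B x μ := by
  rw [gaugeAct, t0GaugeFn_phaseField_eq_one hC hT t hx, t0GaugeFn_phaseField_eq_one hC hT t hx', one_mul, inv_one,
    mul_one]

/-- **`V_t` is in the situation `T0Hyp` of seat p26** (`B15Claim196T0`): the chain geometry, the side bound `W`,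
`U(1) ⊂ U1 ℂ`-valued, and plaquettes within `|t|·s` of `1` on `𝔅₀` when `|(∂B)(p′)| ≤ s` there.
[cite: Balaban1989LargeFieldII, (1.78) p.383] -/
theorem t0Hyp_phaseField (hC : ChainGeom lo hi τ m) {W : ℕ} (hW : ∀ κ, hi 0 κ - lo 0 κ ≤ W) {s : ℝ} (hs : 0 ≤ s)
    (hcurl : CurlBoundOn (B0 lo hi m) B s) (t : ℝ) : T0Hyp lo hi τ m W (phaseField t B) (|t| * s) :=
  ⟨hC, hW, fun _ _ => uexp_mem_U1 _, mul_nonneg (abs_nonneg t) hs, plaqSmallOn_phaseField B hcurl t⟩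

/-- **The limit `t → 0`**: if `‖e^{itβ} − 1‖ ≤ |t|·c` for all `t ≠ 0`, then `|β| ≤ c` (the derivative of `t ↦ e^{itβ}`
at `0` is `iβ`). [folklore] -/
private theorem abs_le_of_norm_cexp_sub_one_le {β c : ℝ}
    (h : ∀ t : ℝ, t ≠ 0 → ‖Complex.exp (I * ((t * β : ℝ) : ℂ)) - 1‖ ≤ |t| * c) : |β| ≤ c := by
  have hd : HasDerivAt (fun t : ℝ => Complex.exp (I * ((t * β : ℝ) : ℂ))) (I * (β : ℂ)) 0 := by
    have h1 : HasDerivAt (fun t : ℝ => ((t * β : ℝ) : ℂ)) β 0 := (hasDerivAt_mul_const β).ofReal_comp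
    simpa using (h1.const_mul I).cexp
  have hn := hd.tendsto_slope_zero.norm
  have hI : ‖I * (β : ℂ)‖ = |β| := by simp
  rw [hI] at hn
  refine le_of_tendsto hn ?_
  filter_upwards [self_mem_nhdsWithin] with t ht
  have ht0 : t ≠ 0 := ht
  have h0 : Complex.exp (I * (((0 : ℝ) * β : ℝ) : ℂ)) = 1 := by simp
  show ‖t⁻¹ • (Complex.exp (I * (((0 + t) * β : ℝ) : ℂ)) - Complex.exp (I * (((0 : ℝ) * β : ℝ) : ℂ)))‖ ≤ c
  rw [h0, zero_add, norm_smul, norm_inv, Real.norm_eq_abs]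
  calc |t|⁻¹ * ‖Complex.exp (I * ((t * β : ℝ) : ℂ)) - 1‖ ≤ |t|⁻¹ * (|t| * c) :=
        mul_le_mul_of_nonneg_left (h t ht0) (inv_nonneg.mpr (abs_nonneg t))
    _ = c := by rw [← mul_assoc, inv_mul_cancel₀ (abs_ne_zero.mpr ht0), one_mul]

/-! ## §3 Every bond of `𝔅₀` -/

/-- **(1.78), ℓ^∞ (Stokes) form on the whole of `𝔅₀`**: for the chain `Λ = P⁰ ⊃ ⋯ ⊃ Pᵐ` of [I] p. 195 (sides of `Λ` of
at most `W + 1` sites, `d = n + 3`), a real bond function `B` in the gauge of `T₀` with `|(∂B)(p′)| ≤ s` for the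
plaquettes `p′` with corners in `𝔅₀` satisfies `|B(b)| ≤ ((d² + 7)W² + dW)·s` for EVERY bond `b` with both ends in `𝔅₀`
— inside a layer or between two successive layers: seat p26's `T0Hyp.norm_gauge_bond_sub_one_le_B0` (the loops closed
through `T₀`, spanned inside the merged annuli `Pⁱ ∖ Pⁱ⁺²`) applied to `V_t = e^{itB}` and `t → 0`.
[cite: Balaban1989LargeFieldII, (1.78) p.383] -/
theorem abs_bond_le_T0 (hC : ChainGeom lo hi τ m) {W : ℕ} (hW : ∀ κ, hi 0 κ - lo 0 κ ≤ W)
    (hT : T0Gauge (mulField B) lo hi τ m) {s : ℝ} (hs : 0 ≤ s) (hcurl : CurlBoundOn (B0 lo hi m) B s)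
    {x : Site (n + 3)} {μ : Fin (n + 3)} (hx : x ∈ B0 lo hi m) (hx' : x + e μ ∈ B0 lo hi m) :
    |B x μ| ≤ ((((n : ℝ) + 3) ^ 2 + 7) * (W : ℝ) ^ 2 + (n + 3) * W) * s := by
  refine abs_le_of_norm_cexp_sub_one_le fun t _ => ?_
  have h := (t0Hyp_phaseField hC hW hs hcurl t).norm_gauge_bond_sub_one_le_B0 hx hx'
  rw [gaugeAct_t0GaugeFn_phaseField hC hT t hx hx', phaseField_val] at h
  calc _ ≤ _ := h
    _ = |t| * (((((n : ℝ) + 3) ^ 2 + 7) * (W : ℝ) ^ 2 + (n + 3) * W) * s) := by ring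

/-! ## §4 (1.78) as printed -/

/-- `𝔅₀ = Λ ∖ Pᵐ` as a set of sites, so that the plaquettes "`p′ ∈ 𝔅₀`" are those of the annulus `Λ ∖ Pᵐ`
(`B16Ineq178.annPlaq`). [cite: Balaban1989LargeFieldI, p.195] -/
theorem B0_eq_ann (hC : ChainGeom lo hi τ m) : B0 lo hi m = ann (lo 0) (hi 0) (lo m) (hi m) :=
  Set.ext fun _ => hC.mem_B0_iff

/-- **The printed constant is met**: `((d² + 7)W² + dW)² ≤ 6(d+3)D^{d+2}` whenever the sides have `W + 1 ≤ D` sites and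
`d ≤ D` (`d = n + 3`). [cite: Balaban1989LargeFieldII, (1.78) p.383] -/
theorem t0Const_sq_le {W : ℕ} {D : ℝ} (hD : (W : ℝ) + 1 ≤ D) (hd : (n : ℝ) + 3 ≤ D) :
    ((((n : ℝ) + 3) ^ 2 + 7) * (W : ℝ) ^ 2 + (n + 3) * W) ^ 2 ≤ 6 * ((n + 3 : ℕ) + 3) * D ^ (n + 3 + 2) := by
  have hW : (0 : ℝ) ≤ W := Nat.cast_nonneg W
  have hn : (0 : ℝ) ≤ n := Nat.cast_nonneg n
  have hWD : (W : ℝ) ≤ D - 1 := by linarith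
  have hD1 : (1 : ℝ) ≤ D := by linarith
  have hD0 : (0 : ℝ) ≤ D := by linarith
  have hcast : (((n + 3 : ℕ) : ℝ) + 3) = ((n : ℝ) + 3) + 3 := by push_cast; ring
  rw [hcast]
  have hN0 : 0 ≤ (((n : ℝ) + 3) ^ 2 + 7) * (W : ℝ) ^ 2 + (n + 3) * W := by positivity
  rcases n with _ | _ | n
  · -- `d = 3`: `N ≤ 16(D−1)² + 3(D−1)` and `(16(D−1)² + 3(D−1))² ≤ 36D⁵` for `D ≥ 3`
    norm_num at hd hN0 ⊢
    have hN : (16 : ℝ) * (W : ℝ) ^ 2 + 3 * W ≤ 16 * (D - 1) ^ 2 + 3 * (D - 1) := by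
      nlinarith [pow_le_pow_left₀ hW hWD 2]
    have hN1 : (0 : ℝ) ≤ 16 * (D - 1) ^ 2 + 3 * (D - 1) := by nlinarith
    refine (pow_le_pow_left₀ (by positivity) hN 2).trans ?_
    obtain ⟨t, ht, rfl⟩ : ∃ t : ℝ, 0 ≤ t ∧ D = t + 3 := ⟨D - 3, by linarith, by ring⟩
    nlinarith [pow_nonneg ht 2, pow_nonneg ht 3, pow_nonneg ht 4, pow_nonneg ht 5]
  · -- `d = 4`: `N ≤ 23D²` and `529D⁴ ≤ 42D⁶` for `D ≥ 4`
    norm_num at hd hN0 ⊢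
    have hN : (23 : ℝ) * (W : ℝ) ^ 2 + 4 * W ≤ 23 * D ^ 2 := by
      nlinarith [pow_le_pow_left₀ hW hWD 2]
    refine (pow_le_pow_left₀ (by positivity) hN 2).trans ?_
    have hD2 : (16 : ℝ) ≤ D ^ 2 := by nlinarith
    nlinarith [pow_nonneg hD0 4, mul_le_mul_of_nonneg_left hD2 (pow_nonneg hD0 4)]
  · -- `d ≥ 5`: `N ≤ (d² + 8)D²`, `(d² + 8)² ≤ 6(d+3)d³ ≤ 6(d+3)D^{d−2}`
    push_cast at hd hN0 ⊢
    have hd5 : (5 : ℝ) ≤ (n : ℝ) + 1 + 1 + 3 := by linarith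
    have hWD' : (W : ℝ) ≤ D := by linarith
    have hN : (((n : ℝ) + 1 + 1 + 3) ^ 2 + 7) * (W : ℝ) ^ 2 + ((n : ℝ) + 1 + 1 + 3) * W ≤
        (((n : ℝ) + 1 + 1 + 3) ^ 2 + 8) * D ^ 2 := by
      have h1 : (W : ℝ) ^ 2 ≤ D ^ 2 := pow_le_pow_left₀ hW hWD' 2
      have h2 : ((n : ℝ) + 1 + 1 + 3) * (W : ℝ) ≤ D * D := mul_le_mul hd hWD' hW hD0
      nlinarith [h1, h2, sq_nonneg ((n : ℝ) + 1 + 1 + 3)]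
    refine (pow_le_pow_left₀ hN0 hN 2).trans ?_
    rw [show n + 1 + 1 + 3 + 2 = 4 + (n + 3) by omega, pow_add, mul_pow, ← pow_mul]
    have hD4 : (0 : ℝ) ≤ D ^ 4 := by positivity
    have h3 : D ^ 3 ≤ D ^ (n + 3) := pow_le_pow_right₀ hD1 (by omega)
    have h4 : ((n : ℝ) + 1 + 1 + 3) ^ 3 ≤ D ^ 3 := pow_le_pow_left₀ (by linarith) hd 3
    have h5 : (((n : ℝ) + 1 + 1 + 3) ^ 2 + 8) ^ 2 ≤
        6 * ((n : ℝ) + 1 + 1 + 3 + 3) * ((n : ℝ) + 1 + 1 + 3) ^ 3 := by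
      nlinarith [hd5, sq_nonneg ((n : ℝ) + 1 + 1 + 3), pow_le_pow_left₀ (by norm_num : (0:ℝ) ≤ 5) hd5 2,
        pow_le_pow_left₀ (by norm_num : (0:ℝ) ≤ 5) hd5 3, pow_le_pow_left₀ (by norm_num : (0:ℝ) ≤ 5) hd5 4]
    have h6 : (0 : ℝ) ≤ 6 * ((n : ℝ) + 1 + 1 + 3 + 3) := by positivity
    calc (((n : ℝ) + 1 + 1 + 3) ^ 2 + 8) ^ 2 * D ^ (2 * 2)
        ≤ (6 * ((n : ℝ) + 1 + 1 + 3 + 3) * D ^ (n + 3)) * D ^ 4 := by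
          refine mul_le_mul_of_nonneg_right ?_ hD4
          calc (((n : ℝ) + 1 + 1 + 3) ^ 2 + 8) ^ 2 ≤ 6 * ((n : ℝ) + 1 + 1 + 3 + 3) * ((n : ℝ) + 1 + 1 + 3) ^ 3 := h5
            _ ≤ 6 * ((n : ℝ) + 1 + 1 + 3 + 3) * D ^ 3 := mul_le_mul_of_nonneg_left h4 h6
            _ ≤ 6 * ((n : ℝ) + 1 + 1 + 3 + 3) * D ^ (n + 3) := mul_le_mul_of_nonneg_left h3 h6
      _ = 6 * ((n : ℝ) + 1 + 1 + 3 + 3) * (D ^ 4 * D ^ (n + 3)) := by ring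

/-- **(1.78) AS TYPED, PROVED on the whole nested gauge `T₀` (real `B`)**: for the chain `Λ = P⁰ ⊃ ⋯ ⊃ Pᵐ` of [IV]
p. 195 (`B15TreeGauge196.ChainGeom`, single-scale model) whose sides have at most `100M(L+1)N^{β₀}R_j` sites (condition
(i) of [IV]: *"contained in a cube of the size 100MR"*, `100MR_{j−N+1} ≦ 100M(L+1)N^{β₀}R_j`) and
`d = n + 3 ≤ 100M(L+1)N^{β₀}R_j`, every real bond function `B` in the gauge of `T₀` ([IV] p. 196, `T0Gauge (mulField B)`:
`B = 0` on the trees of all the layers and on the external bonds joining them) and EVERY bond `b` with both ends in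
`𝔅₀ = Λ ∖ Pᵐ` satisfy `B16Sect1Kernels.Ineq178 |B(b)|² (Σ_{p′⊂𝔅₀}|(∂B)(p′)|²) M L N^{β₀} R_j d`, i.e.
`|B(b)|² ≦ 6(d+3)(100M(L+1)N^{β₀}R_j)^{d+2} Σ_{p′∈𝔅₀}|(∂B)(p′)|²`. [cite: Balaban1989LargeFieldII, (1.78) p.383] -/
theorem ineq178_T0 (hC : ChainGeom lo hi τ m) {M L Nβ Rj : ℝ}
    (hD : ∀ κ, ((hi 0 κ - lo 0 κ : ℤ) : ℝ) + 1 ≤ 100 * M * (L + 1) * Nβ * Rj)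
    (hd : (n : ℝ) + 3 ≤ 100 * M * (L + 1) * Nβ * Rj) (hT : T0Gauge (mulField B) lo hi τ m) {x : Site (n + 3)}
    {μ : Fin (n + 3)} (hx : x ∈ B0 lo hi m) (hx' : x + e μ ∈ B0 lo hi m) :
    B16Sect1Kernels.Ineq178 (B x μ ^ 2) (annPlaqSum (lo 0) (hi 0) (lo m) (hi m) B) M L Nβ Rj (n + 3) := by
  unfold B16Sect1Kernels.Ineq178
  -- the uniform side bound `W` = the largest side of `Λ` (non-negative since `x ∈ Λ`)
  obtain ⟨κ₀, -, hκ₀⟩ := Finset.exists_max_image Finset.univ (fun κ : Fin (n + 3) => hi 0 κ - lo 0 κ)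
    ⟨μ, Finset.mem_univ _⟩
  have hxb := (mem_box_iff.mp (hC.mem_B0_iff.mp hx).1) κ₀
  have hW0 : 0 ≤ hi 0 κ₀ - lo 0 κ₀ := by linarith [hxb.1, hxb.2]
  set W : ℕ := (hi 0 κ₀ - lo 0 κ₀).toNat with hWdef
  have hWZ : ((W : ℕ) : ℤ) = hi 0 κ₀ - lo 0 κ₀ := Int.toNat_of_nonneg hW0
  have hW : ∀ κ, hi 0 κ - lo 0 κ ≤ W := fun κ => by rw [hWZ]; exact hκ₀ κ (Finset.mem_univ _)
  have hWR : (W : ℝ) + 1 ≤ 100 * M * (L + 1) * Nβ * Rj := by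
    have : (W : ℝ) = ((hi 0 κ₀ - lo 0 κ₀ : ℤ) : ℝ) := by exact_mod_cast hWZ
    rw [this]; exact hD κ₀
  have hcurl : CurlBoundOn (B0 lo hi m) B (Real.sqrt (annPlaqSum (lo 0) (hi 0) (lo m) (hi m) B)) := by
    rw [B0_eq_ann hC]; exact curlBoundOn_sqrt B
  have h := abs_bond_le_T0 hC hW hT (Real.sqrt_nonneg _) hcurl hx hx'
  have hS := annPlaqSum_nonneg (lo := lo 0) (hi := hi 0) (lo' := lo m) (hi' := hi m) B
  calc B x μ ^ 2 = |B x μ| ^ 2 := (sq_abs _).symm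
    _ ≤ (((((n : ℝ) + 3) ^ 2 + 7) * (W : ℝ) ^ 2 + (n + 3) * W) *
          Real.sqrt (annPlaqSum (lo 0) (hi 0) (lo m) (hi m) B)) ^ 2 := pow_le_pow_left₀ (abs_nonneg _) h 2
    _ = ((((n : ℝ) + 3) ^ 2 + 7) * (W : ℝ) ^ 2 + (n + 3) * W) ^ 2 * annPlaqSum (lo 0) (hi 0) (lo m) (hi m) B := by
          rw [mul_pow, Real.sq_sqrt hS]
    _ ≤ _ := mul_le_mul_of_nonneg_right (t0Const_sq_le hWR hd) hS

/-- **(1.78) AS TYPED on the whole of `T₀` — 𝔤-valued `B`** in the coordinates `a : Fin k` of an orthonormal basis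
(`|B(b)|² = Σ_a B_a(b)²`, `(∂B)_a = ∂(B_a)`, each coordinate in the gauge of `T₀`), the row's reading.
[cite: Balaban1989LargeFieldII, (1.78) p.383] -/
theorem ineq178_T0_vec (hC : ChainGeom lo hi τ m) {M L Nβ Rj : ℝ}
    (hD : ∀ κ, ((hi 0 κ - lo 0 κ : ℤ) : ℝ) + 1 ≤ 100 * M * (L + 1) * Nβ * Rj)
    (hd : (n : ℝ) + 3 ≤ 100 * M * (L + 1) * Nβ * Rj) {k : ℕ} {Bv : Site (n + 3) → Fin (n + 3) → Fin k → ℝ}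
    (hT : ∀ a, T0Gauge (mulField fun z ν => Bv z ν a) lo hi τ m) {x : Site (n + 3)} {μ : Fin (n + 3)}
    (hx : x ∈ B0 lo hi m) (hx' : x + e μ ∈ B0 lo hi m) :
    B16Sect1Kernels.Ineq178 (∑ a, Bv x μ a ^ 2)
      (∑ p ∈ annPlaq (lo 0) (hi 0) (lo m) (hi m), ∑ a, curl (fun z ν => Bv z ν a) p.1 p.2.1 p.2.2 ^ 2)
      M L Nβ Rj (n + 3) := by
  have hcomp := fun a : Fin k => ineq178_T0 hC hD hd (hT a) hx hx'
  unfold B16Sect1Kernels.Ineq178 at hcomp ⊢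
  calc ∑ a, Bv x μ a ^ 2
      ≤ ∑ a, 6 * ((n + 3 : ℕ) + 3 : ℝ) * (100 * M * (L + 1) * Nβ * Rj) ^ (n + 3 + 2) *
          annPlaqSum (lo 0) (hi 0) (lo m) (hi m) (fun z ν => Bv z ν a) := Finset.sum_le_sum fun a _ => hcomp a
    _ = _ := by rw [← Finset.mul_sum]; unfold annPlaqSum; rw [Finset.sum_comm]

/-! ## §5 (v1.1, append-only). The large-field factor of p. 383 on the concrete carrier

P. 383 (render p029 re-read), verbatim: *"We take the bond b, for which |B(b)| ≧ g_j⁻¹δ′_j = A₁p₁(g_j), and the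
inequalities (1.77), (1.78) yield the following large field factor: exp(−½γ₀[6(d + 3)(100M(L + 1)N^{β₀}R_j)^{d+2}]⁻¹
A₁²p₁(g_j)) < exp(−R_j^{−d−5}p₁²(g_j))"* (misprint `p₁` for `p₁²` on the left, register kind=print, row B16.Lem@381) —
ASSEMBLED here on the `T₀` carrier: (1.78) is `ineq178_T0` above, (1.77) (the positivity input (1.83)–(1.87) of [IV],
row B16.Eq1.77, decl of record `B16Sect1Kernels.Ineq177`) enters as the hypothesis it is, with the concrete plaquette sum
of `𝔅₀`; the arithmetic is r13's `B16Sect1Kernels.form_lower_of_large_bond` / `lfFactor178_of_large` /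
`exp_lfFactor_le_exp_neg_p0` BY NAME.  The constant subtracted in (1.77) (*"We assume that g_j is sufficiently small,
so that the constant on the right-hand side above is small, or O(1)"*) is kept explicit as the factor `e^{c/2}`. -/

/-- **A large bond makes the quadratic form of (1.78) large**: on the `T₀` carrier, a bond `b` of `𝔅₀` with
`|B(b)| ≧ A₁p₁(g_j)` forces `Σ_{p′⊂𝔅₀}|(∂B)(p′)|² ≧ [6(d+3)(100M(L+1)N^{β₀}R_j)^{d+2}]⁻¹(A₁p₁(g_j))²`.
[cite: Balaban1989LargeFieldII, (1.78) p.383] -/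
theorem plaqSum_lower_of_large_bond_T0 (hC : ChainGeom lo hi τ m) {M L Nβ Rj : ℝ}
    (hD : ∀ κ, ((hi 0 κ - lo 0 κ : ℤ) : ℝ) + 1 ≤ 100 * M * (L + 1) * Nβ * Rj)
    (hd : (n : ℝ) + 3 ≤ 100 * M * (L + 1) * Nβ * Rj) (hT : T0Gauge (mulField B) lo hi τ m) {x : Site (n + 3)}
    {μ : Fin (n + 3)} (hx : x ∈ B0 lo hi m) (hx' : x + e μ ∈ B0 lo hi m) {A₁ p₁g : ℝ}
    (hlarge : (A₁ * p₁g) ^ 2 ≤ B x μ ^ 2) :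
    (6 * ((n + 3 : ℕ) + 3) * (100 * M * (L + 1) * Nβ * Rj) ^ (n + 3 + 2))⁻¹ * (A₁ * p₁g) ^ 2 ≤
      annPlaqSum (lo 0) (hi 0) (lo m) (hi m) B := by
  have h78 := ineq178_T0 hC hD hd hT hx hx'
  unfold B16Sect1Kernels.Ineq178 at h78
  have hn : (0 : ℝ) ≤ n := Nat.cast_nonneg n
  have hDpos : 0 < 100 * M * (L + 1) * Nβ * Rj := by linarith
  have hW : 0 < 6 * ((n + 3 : ℕ) + 3 : ℝ) * (100 * M * (L + 1) * Nβ * Rj) ^ (n + 3 + 2) := by positivity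
  rw [inv_mul_le_iff₀ hW]
  exact hlarge.trans h78

/-- **(1.77) + (1.78) ⇒ the quadratic form is large** (p. 383), on the concrete carrier: with (1.77) for the form `Q`
against the plaquette sum of `𝔅₀` (`B16Sect1Kernels.Ineq177`, hypothesis) and a bond of `𝔅₀` with
`|B(b)| ≧ A₁p₁(g_j)`: `Q > γ₀[6(d+3)(100M(L+1)N^{β₀}R_j)^{d+2}]⁻¹(A₁p₁(g_j))² − O(1)A₀A₁²B₃⁴B₅M^{d+6}R_j^{d+3}p₀(g_j)
p₁²(g_j)g_j` — `B16Sect1Kernels.form_lower_of_large_bond` BY NAME. [cite: Balaban1989LargeFieldII, (1.78) p.383] -/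
theorem form_lower_of_large_bond_T0 (hC : ChainGeom lo hi τ m) {M L Nβ Rj : ℝ}
    (hD : ∀ κ, ((hi 0 κ - lo 0 κ : ℤ) : ℝ) + 1 ≤ 100 * M * (L + 1) * Nβ * Rj)
    (hd : (n : ℝ) + 3 ≤ 100 * M * (L + 1) * Nβ * Rj) (hT : T0Gauge (mulField B) lo hi τ m) {x : Site (n + 3)}
    {μ : Fin (n + 3)} (hx : x ∈ B0 lo hi m) (hx' : x + e μ ∈ B0 lo hi m)
    {Q γ₀ C A₀ A₁ B₃ B₅ p₀g p₁g gj : ℝ} (hγ : 0 ≤ γ₀)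
    (h77 : B16Sect1Kernels.Ineq177 Q (annPlaqSum (lo 0) (hi 0) (lo m) (hi m) B) γ₀ C A₀ A₁ B₃ B₅ M Rj p₀g p₁g gj
      (n + 3))
    (hlarge : (A₁ * p₁g) ^ 2 ≤ B x μ ^ 2) :
    γ₀ * (6 * ((n + 3 : ℕ) + 3) * (100 * M * (L + 1) * Nβ * Rj) ^ (n + 3 + 2))⁻¹ * (A₁ * p₁g) ^ 2 -
        C * A₀ * A₁ ^ 2 * B₃ ^ 4 * B₅ * M ^ (n + 3 + 6) * Rj ^ (n + 3 + 3) * p₀g * p₁g ^ 2 * gj < Q := by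
  have h78 := ineq178_T0 hC hD hd hT hx hx'
  unfold B16Sect1Kernels.Ineq178 at h78
  unfold B16Sect1Kernels.Ineq177 at h77
  have hn : (0 : ℝ) ≤ n := Nat.cast_nonneg n
  have hDpos : 0 < 100 * M * (L + 1) * Nβ * Rj := by linarith
  have hW : 0 < 6 * ((n + 3 : ℕ) + 3 : ℝ) * (100 * M * (L + 1) * Nβ * Rj) ^ (n + 3 + 2) := by positivity
  exact B16Sect1Kernels.form_lower_of_large_bond hW hγ h78 h77 hlarge

/-- **The large-field factor of p. 383 on the concrete carrier**: in the situation of `form_lower_of_large_bond_T0`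
and under r13's explicit largeness of `R_j` (`12(d+3)(100M(L+1)N^{β₀})^{d+2} < γ₀A₁²R_j³`, *"g_j sufficiently small"*),
`exp(−½Q) < e^{c/2} · exp(−R_j^{−d−5}p₁²(g_j))`, `c` the constant subtracted in (1.77) —
`B16Sect1Kernels.lfFactor178_of_large` BY NAME. [cite: Balaban1989LargeFieldII, (1.78) p.383] -/
theorem largeFieldFactor_T0 (hC : ChainGeom lo hi τ m) {M L Nβ Rj : ℝ}
    (hD : ∀ κ, ((hi 0 κ - lo 0 κ : ℤ) : ℝ) + 1 ≤ 100 * M * (L + 1) * Nβ * Rj)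
    (hd : (n : ℝ) + 3 ≤ 100 * M * (L + 1) * Nβ * Rj) (hT : T0Gauge (mulField B) lo hi τ m) {x : Site (n + 3)}
    {μ : Fin (n + 3)} (hx : x ∈ B0 lo hi m) (hx' : x + e μ ∈ B0 lo hi m)
    {Q γ₀ C A₀ A₁ B₃ B₅ p₀g p₁g gj : ℝ} (hγ : 0 ≤ γ₀)
    (h77 : B16Sect1Kernels.Ineq177 Q (annPlaqSum (lo 0) (hi 0) (lo m) (hi m) B) γ₀ C A₀ A₁ B₃ B₅ M Rj p₀g p₁g gj
      (n + 3))
    (hlarge : (A₁ * p₁g) ^ 2 ≤ B x μ ^ 2) (hRj : 0 < Rj) (hp : p₁g ≠ 0) (hbase : 0 < 100 * M * (L + 1) * Nβ)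
    (hlargeR : 12 * ((n + 3 : ℕ) + 3) * (100 * M * (L + 1) * Nβ) ^ (n + 3 + 2) < γ₀ * A₁ ^ 2 * Rj ^ 3) :
    Real.exp (-(1 / 2) * Q) <
      Real.exp ((1 / 2) * (C * A₀ * A₁ ^ 2 * B₃ ^ 4 * B₅ * M ^ (n + 3 + 6) * Rj ^ (n + 3 + 3) * p₀g * p₁g ^ 2 * gj)) *
        Real.exp (-(Rj ^ (n + 3 + 5))⁻¹ * p₁g ^ 2) := by
  have hform := form_lower_of_large_bond_T0 hC hD hd hT hx hx' hγ h77 hlarge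
  have hlf := B16Sect1Kernels.lfFactor178_of_large (d := n + 3) hRj hp hbase hlargeR
  unfold B16Sect1Kernels.lfFactor178 at hlf
  set W : ℝ := 6 * ((n + 3 : ℕ) + 3) * (100 * M * (L + 1) * Nβ * Rj) ^ (n + 3 + 2) with hWdef
  set c : ℝ := C * A₀ * A₁ ^ 2 * B₃ ^ 4 * B₅ * M ^ (n + 3 + 6) * Rj ^ (n + 3 + 3) * p₀g * p₁g ^ 2 * gj with hcdef
  have hsq : (A₁ * p₁g) ^ 2 = A₁ ^ 2 * p₁g ^ 2 := mul_pow A₁ p₁g 2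
  have h1 : Real.exp (-(1 / 2) * Q) < Real.exp ((1 / 2) * c + -(1 / 2) * γ₀ * W⁻¹ * A₁ ^ 2 * p₁g ^ 2) := by
    rw [Real.exp_lt_exp]
    rw [hsq] at hform
    nlinarith [hform]
  rw [Real.exp_add] at h1
  exact h1.trans (mul_lt_mul_of_pos_left hlf (Real.exp_pos _))

/-- **… and "we estimate the factors by exp(−p₀(g_j))"**: under the p. 383 proviso `2p₁ − (d + 5)r₀ > p₀`
(`B16Sect1Kernels.ExponentProviso383`, with `p₀(g_j) = ℓ^{p₀}`, `p₁(g_j) = ℓ^{p₁}`, `R_j = ℓ^{r₀}`, `ℓ = log g_j⁻² ≧ 1`)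
the large-field factor is at most `e^{c/2}·exp(−p₀(g_j))` — `B16Sect1Kernels.exp_lfFactor_le_exp_neg_p0` BY NAME.
[cite: Balaban1989LargeFieldII, (1.78) p.383] -/
theorem largeFieldFactor_T0_le_exp_neg_p0 (hC : ChainGeom lo hi τ m) {M L Nβ Rj : ℝ}
    (hD : ∀ κ, ((hi 0 κ - lo 0 κ : ℤ) : ℝ) + 1 ≤ 100 * M * (L + 1) * Nβ * Rj)
    (hd : (n : ℝ) + 3 ≤ 100 * M * (L + 1) * Nβ * Rj) (hT : T0Gauge (mulField B) lo hi τ m) {x : Site (n + 3)}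
    {μ : Fin (n + 3)} (hx : x ∈ B0 lo hi m) (hx' : x + e μ ∈ B0 lo hi m)
    {Q γ₀ C A₀ A₁ B₃ B₅ p₀g p₁g gj : ℝ} (hγ : 0 ≤ γ₀)
    (h77 : B16Sect1Kernels.Ineq177 Q (annPlaqSum (lo 0) (hi 0) (lo m) (hi m) B) γ₀ C A₀ A₁ B₃ B₅ M Rj p₀g p₁g gj
      (n + 3))
    (hlarge : (A₁ * p₁g) ^ 2 ≤ B x μ ^ 2) (hRj : 0 < Rj) (hp : p₁g ≠ 0) (hbase : 0 < 100 * M * (L + 1) * Nβ)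
    (hlargeR : 12 * ((n + 3 : ℕ) + 3) * (100 * M * (L + 1) * Nβ) ^ (n + 3 + 2) < γ₀ * A₁ ^ 2 * Rj ^ 3)
    {ℓ p₀ p₁ r₀ : ℝ} (hℓ : 1 ≤ ℓ) (hp₀ : p₀g = ℓ ^ p₀) (hp₁ : p₁g = ℓ ^ p₁) (hR : Rj = ℓ ^ r₀)
    (hprov : B16Sect1Kernels.ExponentProviso383 p₀ p₁ r₀ (n + 3)) :
    Real.exp (-(1 / 2) * Q) <
      Real.exp ((1 / 2) * (C * A₀ * A₁ ^ 2 * B₃ ^ 4 * B₅ * M ^ (n + 3 + 6) * Rj ^ (n + 3 + 3) * p₀g * p₁g ^ 2 * gj)) *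
        Real.exp (-p₀g) :=
  (largeFieldFactor_T0 hC hD hd hT hx hx' hγ h77 hlarge hRj hp hbase hlargeR).trans_le
    (mul_le_mul_of_nonneg_left (B16Sect1Kernels.exp_lfFactor_le_exp_neg_p0 hℓ hp₀ hp₁ hR hprov) (Real.exp_pos _).le)

end Chain

end Literature.MathematicalPhysics.QuantumFieldTheory.Balaban1983to89.B16Ineq178Nested
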